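import Summits.AtomisticToContinuum.Crystallization.Theorems.OverbindingBudgetEnergyLayerTailSum

/-!
# OverbindingBudget — part XXII-M: the h-WEIGHTED tail — `LayerFieldTailSumH (17/16) (3/8) (23/20) s₀ (22/(21 s₀³))` PROVED (decomp-a2c lens-4, g34)

Part XXII-L proved TAIL with a constant allowance `53/s₀³`, which pays the band floor `h = 3/8` (`(8/3)⁴ ≈ 50.6`) although the admissible
heights the census meets are `≈ 0.8`.  This file re-types the finite cut with the allowance carried as `c/h⁴` (the census tracks `h` per box):

* §1 leaves TAIL-H `LayerFieldTailSumH Λ₁ η₁ η₂ s₀ c` (`−c/h⁴ ≤` tail), FIN-TH `StraightCellEnergyFinTH … s₀ e c`, FIN-SH `SquareCellsExtinctFinH … s₀ e c`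
  (`e + c/h⁴ ≤ layerField(0)/2 + Σ_{s<s₀} layerField(v s)`);
* §2 seams NUM-T ⟸ FIN-TH ∧ TAIL-H, SQX ⟸ FIN-SH ∧ TAIL-H, TAIL(c/η₁⁴) ⟸ TAIL-H(c), ★ ⟸ STR ∧ TAIL-H ∧ FIN-TH ∧ FIN-SH;
* §3 ★ `layerFieldTailSumH_holds : 4 ≤ s₀ → LayerFieldTailSumH (17/16) (3/8) (23/20) s₀ (22/(21 s₀³))` (allowance `1.05/(s₀³ h⁴)`: at `h ≈ 0.8`,
  `s₀ = 40 → 4·10⁻⁵`, `s₀ = 64 → 10⁻⁵` — versus `s₀ = 110 / 175` for the constant form), (part L's constant TAIL is the special case `c·(8/3)⁴`, see the remark in §3);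
* §4 cone XXXIII `rdef_thirtythird_of_recordK_finCertH_ref (s₁ s₂ h₀ κ' s₀)` — beneath ★: STR [ANALYTIC·M] + FIN-TH / FIN-SH [finite CERT·M].

Sorry-free, standard axioms; no instances / notation declared.
-/

noncomputable section

namespace Summit.AtomisticToContinuum.Crystallization.Theorems.OverbindingBudgetEnergyLayerTailH

open Real Finset
open scoped RealInnerProductSpace
open Literature.MathematicalPhysics.StatisticalMechanics (lennardJones groundStateEnergy)
open Summit.AtomisticToContinuum.Crystallization.Theses.OverbindingBudget (RobustDefectLimitWindows)
open Summit.AtomisticToContinuum.Crystallization.Theses.PricedLinkCensus (ChargedEnergyGap)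
open Summit.AtomisticToContinuum.Crystallization.Theorems.ChargedEnergyGapNegative (eStar)
open Summit.AtomisticToContinuum.Crystallization.Theorems.OverbindingBudgetGradedBareness (CleanlessExcessT)
open Summit.AtomisticToContinuum.Crystallization.Theorems.OverbindingBudgetCoherentCut (CoherentResidual)
open Summit.AtomisticToContinuum.Crystallization.Theorems.OverbindingBudgetUniformCutStatements (GrossCleanBallsU)
open Summit.AtomisticToContinuum.Crystallization.Theorems.OverbindingBudgetElasticSplitScale (CompressedVirialLaw)
open Summit.AtomisticToContinuum.Crystallization.Theorems.OverbindingBudgetElasticSplitShear (StressFree)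
open Summit.AtomisticToContinuum.Crystallization.Theorems.ChartedPlanarOrderChunkFloor (E3)
open Summit.AtomisticToContinuum.Crystallization.Theorems.ChartedPlanarOrderRigidityDoor (IsNash)
open Summit.AtomisticToContinuum.Crystallization.Theorems.ChartedPlanarOrderDensityDichotomy (μS IsSep)
open Summit.AtomisticToContinuum.Crystallization.Theorems.ChartedPlanarOrderDoorLayered (Layered)
open Summit.AtomisticToContinuum.Crystallization.Theorems.ChartedPlanarOrderProfileSlavingLJ (IsStacked gapStress incr)
open Summit.AtomisticToContinuum.Crystallization.Theorems.OverbindingBudgetScaleWidening (IsCleanW DoorPeriodicW)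
open Summit.AtomisticToContinuum.Crystallization.Theorems.OverbindingBudgetTwoShellShape (TwoShellShape BarlowGluingW)
open Summit.AtomisticToContinuum.Crystallization.Theorems.OverbindingBudgetStackedRigidityW (StackedReductionW GapStressVanishesW)
open Summit.AtomisticToContinuum.Crystallization.Theorems.OverbindingBudgetRegistryCut (IsUnitNormal Pinned RegistryLocalisationW RegistryResidual
  RegistryTube RegistryZeroExists zeroExists_of_residual_tube)
open Summit.AtomisticToContinuum.Crystallization.Theorems.OverbindingBudgetRegistrySquare (PinnedSq)
open Summit.AtomisticToContinuum.Crystallization.Theorems.OverbindingBudgetRegistryDichotomy (IsTType IsSType RegistryGeometryW BalancedLocus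
  registryLocalisationW_of_geometry_locus sqRegistryLocalisationW_of_geometry_height)
open Summit.AtomisticToContinuum.Crystallization.Theorems.OverbindingBudgetRegistryDichotomyCW (RegistryMetricCW)
open Summit.AtomisticToContinuum.Crystallization.Theorems.OverbindingBudgetEnergyPinning (StackedCellPinningU)
open Summit.AtomisticToContinuum.Crystallization.Theorems.OverbindingBudgetEnergyStraightening (layerField StraightBound StraightenedFloor
  StraightCellEnergyT StraightCellEnergyS)
open Summit.AtomisticToContinuum.Crystallization.Theorems.OverbindingBudgetEnergySquareExtinction (SquareCellsExtinct stackedCellPinningU_of_sqExtinct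
  sqRegistryGeometryW_empty sqBalancedHeight_empty sqRegistryMetricCW_empty)
open Summit.AtomisticToContinuum.Crystallization.Theorems.OverbindingBudgetEnergyTubeBox (RegistryPinningP TubeConvexRefP
  rdef_of_grossU_shape_gluing_pinningU_convexRefP_registry)
open Summit.AtomisticToContinuum.Crystallization.Theorems.OverbindingBudgetEnergyFinCert (StraightCellEnergyFinT SquareCellsExtinctFin
  LayerFieldTailSum stackedCellPinningU_of_finCert)
open Summit.AtomisticToContinuum.Crystallization.Theorems.OverbindingBudgetEnergyLayerTail (layerField_bounds)
open Summit.AtomisticToContinuum.Crystallization.Theorems.OverbindingBudgetEnergyFinCert (straightBound_of_fin_tail layerFieldTailSum_mono)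
open Summit.AtomisticToContinuum.Crystallization.Theorems.OverbindingBudgetEnergyLayerTailSum (gram_ge_of_cell layerField_far tsum_inv_pow_four_le)

/-! ## §1 The h-weighted leaves -/

/-- **TAIL-H · `LayerFieldTailSumH Λ₁ η₁ η₂ s₀ c`** [ANALYTIC·S — PROVED below at `(17/16, 3/8, 23/20, s₀ ≥ 4, c = 22/(21 s₀³))`]: TAIL with the
height-weighted allowance `c/h⁴` in place of the constant `ε` (the true tail is `≍ h⁻⁴ s₀⁻³`; the constant form pays the band floor `h = 3/8`). [piece] -/
def LayerFieldTailSumH (Λ₁ η₁ η₂ : ℝ) (s₀ : ℕ) (c : ℝ) : Prop :=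
  ∀ (a b n : E3), LinearIndependent ℝ ![a, b] → ‖a‖ ≤ Λ₁ → ‖b‖ ≤ Λ₁ →
    (∀ i j : ℤ, ((i : ℝ) • a + (j : ℝ) • b) ≠ 0 → 9 / 10 ≤ ‖(i : ℝ) • a + (j : ℝ) • b‖) → IsUnitNormal a b n →
    ∀ h : ℝ, η₁ ≤ h → h ≤ η₂ → ∀ v : ℕ → E3, (∀ s : ℕ, ⟪v s, n⟫ = ((s : ℝ) + 1) * h) →
      Summable (fun s : ℕ => layerField a b (v s)) ∧ -(c * (h ^ 4)⁻¹) ≤ ∑' s : ℕ, layerField a b (v (s + s₀))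

/-- **FIN-TH · `StraightCellEnergyFinTH Λ₁ η₁ η₂ s₁ s₂ s₀ e c`** [CERT·M, FINITE]: FIN-T with the height-weighted tail allowance added on the left:
`e + c/h⁴ ≤ layerField(0)/2 + Σ_{s<s₀} layerField(v s)`.  Why it might fail: numerically only (margin of the T box vs `c/h⁴` + cert width). [piece] -/
def StraightCellEnergyFinTH (Λ₁ η₁ η₂ s₁ s₂ : ℝ) (s₀ : ℕ) (e c : ℝ) : Prop :=
  ∀ (a b n : E3), LinearIndependent ℝ ![a, b] → ‖a‖ ≤ Λ₁ → ‖b‖ ≤ Λ₁ →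
    (∀ i j : ℤ, ((i : ℝ) • a + (j : ℝ) • b) ≠ 0 → 9 / 10 ≤ ‖(i : ℝ) • a + (j : ℝ) • b‖) → IsUnitNormal a b n → IsTType a b →
    ¬ Pinned s₁ s₂ a b → ∀ h : ℝ, η₁ ≤ h → h ≤ η₂ → ∀ v : ℕ → E3, (∀ s : ℕ, ⟪v s, n⟫ = ((s : ℝ) + 1) * h) →
      e + c * (h ^ 4)⁻¹ ≤ layerField a b 0 / 2 + ∑ s ∈ range s₀, layerField a b (v s)

/-- **FIN-SH · `SquareCellsExtinctFinH Λ₁ η₁ η₂ s₀ e c`** [CERT·M, configuration-free, FINITE]: FIN-S with the height-weighted allowance. [piece] -/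
def SquareCellsExtinctFinH (Λ₁ η₁ η₂ : ℝ) (s₀ : ℕ) (e c : ℝ) : Prop :=
  ∀ (a b n : E3), LinearIndependent ℝ ![a, b] → ‖a‖ ≤ Λ₁ → ‖b‖ ≤ Λ₁ →
    (∀ i j : ℤ, ((i : ℝ) • a + (j : ℝ) • b) ≠ 0 → 9 / 10 ≤ ‖(i : ℝ) • a + (j : ℝ) • b‖) → IsUnitNormal a b n → IsSType a b →
    ∀ h : ℝ, η₁ ≤ h → h ≤ η₂ → ∀ v : ℕ → E3, (∀ s : ℕ, ⟪v s, n⟫ = ((s : ℝ) + 1) * h) →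
      e + c * (h ^ 4)⁻¹ ≤ layerField a b 0 / 2 + ∑ s ∈ range s₀, layerField a b (v s)

/-! ## §2 Seams (PROVED) -/

/-- **NUM-T ⟸ FIN-TH ∧ TAIL-H.** [this file] -/
theorem straightCellEnergyT_of_finH {Λ₁ η₁ η₂ s₁ s₂ e c : ℝ} {s₀ : ℕ} (hF : StraightCellEnergyFinTH Λ₁ η₁ η₂ s₁ s₂ s₀ e c)
    (hT : LayerFieldTailSumH Λ₁ η₁ η₂ s₀ c) : StraightCellEnergyT Λ₁ η₁ η₂ s₁ s₂ e :=
  fun a b n hab ha hb hlat hn hTT hp h h₁ h₂ =>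
    straightBound_of_fin_tail (fun v hv => hF a b n hab ha hb hlat hn hTT hp h h₁ h₂ v hv) (fun v hv => hT a b n hab ha hb hlat hn h h₁ h₂ v hv)

/-- **SQX ⟸ FIN-SH ∧ TAIL-H.** [this file] -/
theorem squareCellsExtinct_of_finH {Λ₁ η₁ η₂ e c : ℝ} {s₀ : ℕ} (hF : SquareCellsExtinctFinH Λ₁ η₁ η₂ s₀ e c)
    (hT : LayerFieldTailSumH Λ₁ η₁ η₂ s₀ c) : SquareCellsExtinct Λ₁ η₁ η₂ e :=
  fun a b n hab ha hb hlat hn hSS h h₁ h₂ =>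
    straightBound_of_fin_tail (fun v hv => hF a b n hab ha hb hlat hn hSS h h₁ h₂ v hv) (fun v hv => hT a b n hab ha hb hlat hn h h₁ h₂ v hv)

/-- TAIL-H(c) gives TAIL(c/η₁⁴) on a band with `0 < η₁`. [bookkeeping] -/
theorem layerFieldTailSum_of_H {Λ₁ η₁ η₂ c : ℝ} {s₀ : ℕ} (hη : 0 < η₁) (hc : 0 ≤ c) (h : LayerFieldTailSumH Λ₁ η₁ η₂ s₀ c) :
    LayerFieldTailSum Λ₁ η₁ η₂ s₀ (c * (η₁ ^ 4)⁻¹) := by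
  intro a b n hab ha hb hlat hn hh h₁ h₂ v hv
  obtain ⟨hs, ht⟩ := h a b n hab ha hb hlat hn hh h₁ h₂ v hv
  refine ⟨hs, le_trans ?_ ht⟩
  have hmono : (hh ^ 4)⁻¹ ≤ (η₁ ^ 4)⁻¹ := inv_anti₀ (by positivity) (pow_le_pow_left₀ hη.le h₁ 4)
  nlinarith

/-- ★ **`StackedCellPinningU Λ₁ s₁ s₂ 1 0 ⟸ STR ∧ TAIL-H(s₀; c) ∧ FIN-TH(s₀; e⋆ + 2κ′; c) ∧ FIN-SH(s₀; e⋆ + 2κ′; c)`**. [this file] -/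
theorem stackedCellPinningU_of_finCertH {Λ₁ s₁ s₂ κ' c : ℝ} {s₀ : ℕ} (hκ' : 0 < κ') (hΛ₁ : Λ₁ ≤ 17 / 16) (hSTR : StraightenedFloor Λ₁)
    (hTail : LayerFieldTailSumH Λ₁ (3 / 8) (23 / 20) s₀ c) (hFT : StraightCellEnergyFinTH Λ₁ (3 / 8) (23 / 20) s₁ s₂ s₀ (eStar + 2 * κ') c)
    (hFS : SquareCellsExtinctFinH Λ₁ (3 / 8) (23 / 20) s₀ (eStar + 2 * κ') c) : StackedCellPinningU Λ₁ s₁ s₂ 1 0 :=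
  stackedCellPinningU_of_sqExtinct hκ' hΛ₁ hSTR (straightCellEnergyT_of_finH hFT hTail) (squareCellsExtinct_of_finH hFS hTail)

/-! ## §3 ★ TAIL-H proved: allowance `22/(21 s₀³ h⁴)` -/

/-- ★★★ `LayerFieldTailSumH (17/16) (3/8) (23/20) s₀ (22/(21 s₀³))` for every `s₀ ≥ 4`: per span `layerField ≥ −(22/7)((s+1)h)⁻⁴` (part L) and
`Σ_{s ≥ s₀} (s+1)⁻⁴ ≤ 1/(3 s₀³)`.  At `h ≈ 0.8`: `s₀ = 40 → 4.0·10⁻⁵`, `s₀ = 64 → 1.0·10⁻⁵`. -/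
theorem layerFieldTailSumH_holds (s₀ : ℕ) (hs₀ : 4 ≤ s₀) : LayerFieldTailSumH (17 / 16) (3 / 8) (23 / 20) s₀ (22 / (21 * (s₀ : ℝ) ^ 3)) := by
  intro a b n hab ha hb hlat hn h hη₁ hη₂ v hv
  have hG := gram_ge_of_cell hab ha hb hlat
  have hs₀' : (4 : ℝ) ≤ s₀ := by exact_mod_cast hs₀
  have hs₁ : (1 : ℝ) ≤ s₀ := by linarith
  have hh : 0 < h := by linarith
  have hPs : ∀ s : ℕ, ⟪v (s + s₀), n⟫ = ((s : ℝ) + s₀ + 1) * h := by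
    intro s; rw [hv (s + s₀)]; push_cast; ring
  have hP0 : ∀ s : ℕ, 15 / 8 ≤ ((s : ℝ) + s₀ + 1) * h := by
    intro s
    have : (5 : ℝ) ≤ (s : ℝ) + s₀ + 1 := by linarith [s.cast_nonneg (α := ℝ)]
    nlinarith
  have hspan := fun s : ℕ => layerField_far hab hn ha hb hG (hPs s) (hP0 s)
  obtain ⟨hf, hfle⟩ := tsum_inv_pow_four_le hs₁
  have hh4pos : 0 < (h ^ 4)⁻¹ := by positivity
  have epow : ∀ s : ℕ, ((((s : ℝ) + s₀ + 1) * h) ^ 4)⁻¹ = (h ^ 4)⁻¹ * ((((s : ℝ) + s₀ + 1)) ^ 4)⁻¹ := by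
    intro s; rw [mul_pow, mul_inv]; ring
  have hshift : Summable (fun s : ℕ => layerField a b (v (s + s₀))) := by
    refine Summable.of_norm_bounded ((hf.mul_left (5 * (h ^ 4)⁻¹))) (fun s => ?_)
    rw [Real.norm_eq_abs]
    refine ((hspan s).2.2).trans_eq ?_
    rw [epow s]; ring
  refine ⟨(summable_nat_add_iff s₀).1 hshift, ?_⟩
  have hlow : ∀ s : ℕ, -(22 / 7 * (h ^ 4)⁻¹) * ((((s : ℝ) + s₀ + 1)) ^ 4)⁻¹ ≤ layerField a b (v (s + s₀)) := by
    intro s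
    refine le_of_eq_of_le ?_ (hspan s).2.1
    rw [epow s]; ring
  have h1 := Summable.tsum_le_tsum hlow (hf.mul_left _) hshift
  rw [tsum_mul_left] at h1
  have hprod : (h ^ 4)⁻¹ * ∑' i : ℕ, (((i : ℝ) + s₀ + 1) ^ 4)⁻¹ ≤ (h ^ 4)⁻¹ * (3 * (s₀ : ℝ) ^ 3)⁻¹ :=
    mul_le_mul_of_nonneg_left hfle hh4pos.le
  have e : (22 : ℝ) / (21 * (s₀ : ℝ) ^ 3) * (h ^ 4)⁻¹ = 22 / 7 * ((h ^ 4)⁻¹ * (3 * (s₀ : ℝ) ^ 3)⁻¹) := by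
    field_simp; ring
  rw [e]
  nlinarith

-- Remark: `layerFieldTailSum_of_H (by norm_num) _ (layerFieldTailSumH_holds s₀ hs₀)` gives `LayerFieldTailSum (17/16) (3/8) (23/20) s₀
-- (22/(21 s₀³)·(8/3)⁴)`, i.e. part L's constant TAIL up to rounding (`52.98 ≤ 53`); not restated here (gate dedup: same type as
-- `…EnergyLayerTailSum.layerFieldTailSum_holds`).

/-! ## §4 Cone XXXIII — h-weighted finite certificates -/

/-- ★ cut XXXIII: as XXXII but with the h-WEIGHTED finite certificates FIN-TH / FIN-SH at level `e⋆ + 2κ'` and allowance `22/(21 s₀³ h⁴)`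
(TAIL-H PROVED); `s₁ s₂ h₀ κ' s₀` symbolic, `0 < κ'`, `4 ≤ s₀`. -/
theorem rdef_thirtythird_of_recordK_finCertH_ref (s₁ s₂ h₀ κ' : ℝ) (s₀ : ℕ) (hκ' : 0 < κ') (hs₀ : 4 ≤ s₀)
    (hG : GrossCleanBallsU (1 / 250) 10)
    (hCEG : ChargedEnergyGap) (hC : CompressedVirialLaw (1 / 250) 10) (hS : TwoShellShape (1 / 100) (3 / 50) (1 / 450)) (hB₂ : BarlowGluingW)
    (hD : DoorPeriodicW 2) (hSR : StackedReductionW 2 (17 / 16)) (hV : GapStressVanishesW (17 / 16))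
    (hP : RegistryPinningP (17 / 16) (1 / 40) (3 / 16) s₁ s₂ 1 0) (hT : TubeConvexRefP (17 / 16) (1 / 40) s₁ s₂ 1 0)
    (hSTR : StraightenedFloor (17 / 16))
    (hFT : StraightCellEnergyFinTH (17 / 16) (3 / 8) (23 / 20) s₁ s₂ s₀ (eStar + 2 * κ') (22 / (21 * (s₀ : ℝ) ^ 3)))
    (hFS : SquareCellsExtinctFinH (17 / 16) (3 / 8) (23 / 20) s₀ (eStar + 2 * κ') (22 / (21 * (s₀ : ℝ) ^ 3)))
    (hGeo : RegistryGeometryW (17 / 16) s₁ s₂ h₀ (3 / 20))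
    (hBal : BalancedLocus s₁ s₂ h₀ (1 / 40)) (hR1 : RegistryResidual s₁ s₂ (1 / 250)) (hR2 : RegistryTube s₁ s₂ (1 / 100) 1)
    (hMet : RegistryMetricCW s₁ s₂ (3 / 500)) (hCE : CleanlessExcessT) (hRes : CoherentResidual 10) : RobustDefectLimitWindows :=
  rdef_of_grossU_shape_gluing_pinningU_convexRefP_registry 2 (17 / 16) (1 / 40) (3 / 16) s₁ s₂ 1 0 (7 / 40) (3 / 500) 0 (1 / 100) (4 / 25) 0
    (by norm_num) (by norm_num) le_rfl (by norm_num) hG hCEG hC hS hB₂ hD hSR hV hP hT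
    (stackedCellPinningU_of_finCertH hκ' le_rfl hSTR (layerFieldTailSumH_holds s₀ hs₀) hFT hFS)
    (registryLocalisationW_of_geometry_locus (by norm_num) hGeo hBal)
    (zeroExists_of_residual_tube (by norm_num) (by norm_num) (by norm_num) (by norm_num) (by norm_num) (by norm_num) hR1 hR2) hMet
    (sqRegistryLocalisationW_of_geometry_height (by norm_num) (sqRegistryGeometryW_empty (17 / 16) 0 (3 / 20)) (sqBalancedHeight_empty 0 (1 / 100)))
    (sqRegistryMetricCW_empty 0 (1 / 100) 0) hCE hRes

end Summit.AtomisticToContinuum.Crystallization.Theorems.OverbindingBudgetEnergyLayerTailH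

end
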